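import Mathlib
import Literature.Analysis.UnboundedOperators.ConjugateOperatorRegularity
import HarnessLib
import Summits.AtomisticToContinuum.FouriersLaw.Theorems.EmbeddedDrudeMourreMourreDissolutionLAPRegularityAlgebraMul

/-!
# Stub `stub_mourreThresholdLAP` — Mourre LAP infrastructure 11: the unitary group `e^{iτB}` of a bounded self-adjoint `B ∈ C¹ ∩ 𝒞^{1,1}`

Item `stmt-AtomisticToContinuum-12594` (crux `MourreDissolution` of route `EmbeddedDrudeMourre`,
sub-problem `FouriersLaw`), line `separable-vertex-faddeev-pair-sector`, stub S6
`stub_mourreThresholdLAP` (Mourre's limiting absorption principle; NOT in the tree). Second step of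
L3 of the proof map (ABG Thm 6.2.5: `H ∈ 𝒞^{1,1}(A) ⇒ φ(H) ∈ 𝒞^{1,1}(A; H)` for `φ ∈ C_c^∞`),
route (b): smooth functions of `H` are realised as Fourier integrals over the NORM-continuous
unitary groups `e^{iτB}` of bounded self-adjoint functions `B` of `H` taken from the resolvent
algebra (which are in `C¹ ∩ 𝒞^{1,1}` by parts 7–9). This file treats one such group:

* §1 `expI B τ = e^{iτB}` (`NormedSpace.exp`): group law, norm-derivative `iB e^{iτB}`,
  unitarity for self-adjoint `B` (`‖e^{iτB}‖ ≤ 1`), and covariance `𝒲(x)[e^{iτB}] = e^{iτ𝒲(x)[B]}`;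
* §2 Duhamel bounds by the mean value inequality: `‖e^{iτB₁} - e^{iτB₀}‖ ≤ |τ| ‖B₁ - B₀‖` and the
  second-order version `‖[𝒲(x) - 1]² e^{iτB}‖ ≤ |τ| (‖[𝒲(x) - 1]² B‖ + 2|τ| ‖𝒲(x)B - B‖²)`;
* §3 regularity: `B ∈ C¹(A; H) ⇒ e^{iτB} ∈ C¹(A; H)` (term-wise differentiation of the exponential
  series) with `‖[e^{iτB}, iA]‖ ≤ |τ| ‖[B, iA]‖` (from the Lipschitz bound), norm-continuity of
  `τ ↦ [e^{iτB}, iA]`, and `B ∈ C¹ ∩ 𝒞^{1,1} ⇒ e^{iτB} ∈ 𝒞^{1,1}` with the pointwise bound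
  `‖[𝒲(x) - 1]² e^{iτB}‖ / x² ≤ |τ| ‖[𝒲(x) - 1]² B‖ / x² + 2 τ² ‖[B, iA]‖²` (polynomial in `τ`, so
  that Schwartz superpositions `∫ ĝ(τ) e^{iτB} dτ` stay in the class — next file).
-/

noncomputable section

open MeasureTheory Complex Filter Topology Set
open scoped InnerProductSpace ComplexConjugate ENNReal NNReal

namespace Summit.AtomisticToContinuum.FouriersLaw.Theorems.MourreDissolution

open Literature.Analysis.UnboundedOperators
open Literature.Analysis.UnboundedOperators.UnitaryRep

variable {H : Type*} [NormedAddCommGroup H] [InnerProductSpace ℂ H] [CompleteSpace H]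

/-! ## §1. The norm-continuous unitary group `e^{iτB}` -/

/- Mathlib states the algebraic identities of `NormedSpace.exp` (group law, unitarity, conjugation
invariance, continuity) over a normed `ℚ`-algebra structure; on `B(H)` it is supplied proof-locally
by `let _ : NormedAlgebra ℚ (H →L[ℂ] H) := .restrictScalars ℚ ℂ _` (the Mathlib idiom, cf.
`Mathlib.Analysis.CStarAlgebra.Fuglede`), never as an instance. -/

/-- **The unitary group of a bounded operator**: `expI B τ = e^{iτB} = exp(τ · iB)` (norm-convergent
exponential series). [folklore] -/
def expI (B : H →L[ℂ] H) (τ : ℝ) : H →L[ℂ] H :=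
  NormedSpace.exp (τ • (I • B))

/-- `e^{i0B} = 1`. [folklore] -/
@[simp] theorem expI_zero (B : H →L[ℂ] H) : expI B 0 = 1 := by
  simp [expI]

omit [CompleteSpace H] in
/-- The exponents `σ · iB` and `τ · iB` commute. [folklore] -/
theorem commute_smul_smul (B : H →L[ℂ] H) (σ τ : ℝ) : Commute (σ • (I • B)) (τ • (I • B)) :=
  ((Commute.refl (I • B)).smul_left σ).smul_right τ

/-- **Group law** `e^{i(σ+τ)B} = e^{iσB} e^{iτB}`. [folklore] -/
theorem expI_add (B : H →L[ℂ] H) (σ τ : ℝ) : expI B (σ + τ) = expI B σ * expI B τ := by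
  let _ : NormedAlgebra ℚ (H →L[ℂ] H) := .restrictScalars ℚ ℂ _
  unfold expI
  rw [add_smul, NormedSpace.exp_add_of_commute (commute_smul_smul B σ τ)]

/-- `e^{iσB}` and `e^{iτB}` commute. [folklore] -/
theorem expI_comm (B : H →L[ℂ] H) (σ τ : ℝ) : expI B σ * expI B τ = expI B τ * expI B σ := by
  rw [← expI_add, add_comm, expI_add]

/-- `e^{-iτB} e^{iτB} = 1`. [folklore] -/
theorem expI_neg_mul (B : H →L[ℂ] H) (τ : ℝ) : expI B (-τ) * expI B τ = 1 := by
  rw [← expI_add, neg_add_cancel, expI_zero]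

/-- `e^{iτB} e^{-iτB} = 1`. [folklore] -/
theorem expI_mul_neg (B : H →L[ℂ] H) (τ : ℝ) : expI B τ * expI B (-τ) = 1 := by
  rw [← expI_add, add_neg_cancel, expI_zero]

/-- `B` commutes with `e^{iτB}`. [folklore] -/
theorem commute_expI (B : H →L[ℂ] H) (τ : ℝ) : Commute B (expI B τ) := by
  let _ : NormedAlgebra ℚ (H →L[ℂ] H) := .restrictScalars ℚ ℂ _
  unfold expI
  exact (((Commute.refl B).smul_right I).smul_right τ).exp_right

/-- **Norm continuity** of `τ ↦ e^{iτB}`. [folklore] -/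
theorem continuous_expI (B : H →L[ℂ] H) : Continuous fun τ : ℝ => expI B τ := by
  let _ : NormedAlgebra ℚ (H →L[ℂ] H) := .restrictScalars ℚ ℂ _
  unfold expI
  fun_prop

/-- **Norm derivative** `d/dτ e^{iτB} = iB e^{iτB}`. [folklore] -/
theorem hasDerivAt_expI (B : H →L[ℂ] H) (τ : ℝ) :
    HasDerivAt (fun σ : ℝ => expI B σ) ((I • B) * expI B τ) τ :=
  hasDerivAt_exp_smul_const' (𝕂 := ℝ) (I • B) τ

/-- **Norm derivative** `d/dτ e^{iτB} = e^{iτB} iB`. [folklore] -/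
theorem hasDerivAt_expI' (B : H →L[ℂ] H) (τ : ℝ) :
    HasDerivAt (fun σ : ℝ => expI B σ) (expI B τ * (I • B)) τ :=
  hasDerivAt_exp_smul_const (𝕂 := ℝ) (I • B) τ

/-- The exponent `τ · iB` is skew-adjoint for self-adjoint `B`. [folklore] -/
theorem star_smul_I_smul {B : H →L[ℂ] H} (hB : IsSelfAdjoint B) (τ : ℝ) :
    star (τ • (I • B)) = -(τ • (I • B)) := by
  rw [← Complex.coe_smul, smul_smul, star_smul, hB.star_eq, ← neg_smul]
  congr 1
  simp [Complex.conj_ofReal]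

/-- **`e^{iτB}` is unitary for self-adjoint `B`.** [folklore] -/
theorem expI_mem_unitary {B : H →L[ℂ] H} (hB : IsSelfAdjoint B) (τ : ℝ) :
    expI B τ ∈ unitary (H →L[ℂ] H) := by
  let _ : NormedAlgebra ℚ (H →L[ℂ] H) := .restrictScalars ℚ ℂ _
  exact NormedSpace.exp_mem_unitary_of_mem_skewAdjoint
    (skewAdjoint.mem_iff.2 (star_smul_I_smul hB τ))

/-- `(e^{iτB})* = e^{-iτB}` for self-adjoint `B`. [folklore] -/
theorem star_expI {B : H →L[ℂ] H} (hB : IsSelfAdjoint B) (τ : ℝ) :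
    star (expI B τ) = expI B (-τ) := by
  unfold expI
  rw [NormedSpace.star_exp, star_smul_I_smul hB, neg_smul]

/-- `‖e^{iτB} f‖ = ‖f‖` for self-adjoint `B`. [folklore] -/
theorem norm_expI_apply {B : H →L[ℂ] H} (hB : IsSelfAdjoint B) (τ : ℝ) (f : H) :
    ‖expI B τ f‖ = ‖f‖ :=
  (expI B τ).norm_map_of_mem_unitary (expI_mem_unitary hB τ) f

/-- `‖e^{iτB}‖ ≤ 1` for self-adjoint `B`. [folklore] -/
theorem norm_expI_le_one {B : H →L[ℂ] H} (hB : IsSelfAdjoint B) (τ : ℝ) : ‖expI B τ‖ ≤ 1 :=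
  ContinuousLinearMap.opNorm_le_bound _ zero_le_one fun f => by
    rw [norm_expI_apply hB, one_mul]

/-- `𝒲(x)` preserves self-adjointness. [folklore] -/
theorem isSelfAdjoint_conjAut (A : OneParameterUnitaryGroup H) (x : ℝ) {B : H →L[ℂ] H}
    (hB : IsSelfAdjoint B) : IsSelfAdjoint (A.conjAut x B) := by
  rw [IsSelfAdjoint, star_conjAut, hB.star_eq]

/-- `W(-x)` as a unit of `B(H)` with inverse `W(x)`. [folklore] -/
def appRealUnit (A : OneParameterUnitaryGroup H) (x : ℝ) : (H →L[ℂ] H)ˣ where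
  val := A.appReal (-x)
  inv := A.appReal x
  val_inv := by rw [← appReal_add, neg_add_cancel, appReal_zero]
  inv_val := by rw [← appReal_add, add_neg_cancel, appReal_zero]

/-- `𝒲(x)[S] = u S u⁻¹` for the unit `u = W(-x)`. [folklore] -/
theorem conjAut_eq_units_conj (A : OneParameterUnitaryGroup H) (x : ℝ) (S : H →L[ℂ] H) :
    A.conjAut x S = (appRealUnit A x : H →L[ℂ] H) * S * ↑(appRealUnit A x)⁻¹ := rfl

/-- **Covariance** `𝒲(x)[e^{iτB}] = e^{iτ 𝒲(x)[B]}` (`𝒲(x)` is an inner automorphism of `B(H)`).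
[folklore] -/
theorem conjAut_expI (A : OneParameterUnitaryGroup H) (x : ℝ) (B : H →L[ℂ] H) (τ : ℝ) :
    A.conjAut x (expI B τ) = expI (A.conjAut x B) τ := by
  let _ : NormedAlgebra ℚ (H →L[ℂ] H) := .restrictScalars ℚ ℂ _
  unfold expI
  rw [conjAut_eq_units_conj, conjAut_eq_units_conj, ← NormedSpace.exp_units_conj]
  congr 1
  rw [← Complex.coe_smul, ← Complex.coe_smul, smul_smul, smul_smul, mul_smul_comm, smul_mul_assoc]

/-! ## §2. Duhamel bounds via the mean value inequality -/

/-- **First-order Duhamel bound**: `‖e^{iτB₁} - e^{iτB₀}‖ ≤ |τ| ‖B₁ - B₀‖` for self-adjoint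
`B₀, B₁` (the function `σ ↦ e^{iσB₁} e^{i(τ-σ)B₀}` has derivative `e^{iσB₁} i(B₁ - B₀) e^{i(τ-σ)B₀}`
of norm `≤ ‖B₁ - B₀‖`). [folklore] -/
theorem norm_expI_sub_expI_le {B₀ B₁ : H →L[ℂ] H} (h₀ : IsSelfAdjoint B₀) (h₁ : IsSelfAdjoint B₁)
    (τ : ℝ) : ‖expI B₁ τ - expI B₀ τ‖ ≤ |τ| * ‖B₁ - B₀‖ := by
  have hG : ∀ σ : ℝ, HasDerivAt (fun σ : ℝ => expI B₁ σ * expI B₀ (τ - σ))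
      (expI B₁ σ * (I • (B₁ - B₀)) * expI B₀ (τ - σ)) σ := by
    intro σ
    have h2 : HasDerivAt (fun σ : ℝ => expI B₀ (τ - σ)) (-((I • B₀) * expI B₀ (τ - σ))) σ := by
      have := (hasDerivAt_expI B₀ (τ - σ)).scomp σ ((hasDerivAt_id σ).const_sub τ)
      simpa [Function.comp_def] using this
    refine ((hasDerivAt_expI' B₁ σ).mul h2).congr_deriv ?_
    simp only [smul_sub, mul_sub, sub_mul, mul_neg, smul_mul_assoc, mul_smul_comm, mul_assoc]
    abel
  have hbound : ∀ σ ∈ (Set.univ : Set ℝ),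
      ‖expI B₁ σ * (I • (B₁ - B₀)) * expI B₀ (τ - σ)‖ ≤ ‖B₁ - B₀‖ := fun σ _ => by
    calc ‖expI B₁ σ * (I • (B₁ - B₀)) * expI B₀ (τ - σ)‖
        ≤ ‖expI B₁ σ‖ * ‖I • (B₁ - B₀)‖ * ‖expI B₀ (τ - σ)‖ := norm_mul₃_le
      _ ≤ 1 * ‖I • (B₁ - B₀)‖ * 1 := by
          gcongr
          · exact norm_expI_le_one h₁ σ
          · exact norm_expI_le_one h₀ _
      _ = ‖B₁ - B₀‖ := by rw [norm_smul, Complex.norm_I]; ring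
  have key := convex_univ.norm_image_sub_le_of_norm_hasDerivWithin_le
    (fun σ _ => (hG σ).hasDerivWithinAt) hbound (Set.mem_univ 0) (Set.mem_univ τ)
  simpa [mul_comm] using key

/-- `|σ| ≤ |τ|` on the unordered interval between `0` and `τ`. [folklore] -/
theorem abs_le_abs_of_mem_uIcc {σ τ : ℝ} (h : σ ∈ Set.uIcc 0 τ) : |σ| ≤ |τ| := by
  simpa using abs_sub_left_of_mem_uIcc h

/-- **Second-order Duhamel bound**: for self-adjoint `B` and `B_j = 𝒲(jx)[B]`,
`‖[𝒲(x) - 1]² e^{iτB}‖ ≤ |τ| (‖[𝒲(x) - 1]² B‖ + 2 |τ| ‖𝒲(x)B - B‖²)` (mean value inequality for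
`σ ↦ e^{iσB₂} e^{i(τ-σ)B₀} - 2 e^{iσB₁} e^{i(τ-σ)B₀}`, whose derivative is
`e^{iσB₂} i[𝒲(x)-1]²B e^{i(τ-σ)B₀} + 2(e^{iσB₂} - e^{iσB₁}) i(B₁ - B₀) e^{i(τ-σ)B₀}`). [folklore] -/
theorem norm_secondDifference_expI_le (A : OneParameterUnitaryGroup H) {B : H →L[ℂ] H}
    (hB : IsSelfAdjoint B) (x τ : ℝ) :
    ‖A.secondDifference x (expI B τ)‖ ≤
      |τ| * (‖A.secondDifference x B‖ + 2 * |τ| * ‖A.conjAut x B - B‖ ^ 2) := by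
  set B₁ := A.conjAut x B with hB₁
  set B₂ := A.conjAut (2 * x) B with hB₂
  have h₁ : IsSelfAdjoint B₁ := isSelfAdjoint_conjAut A x hB
  have h₂ : IsSelfAdjoint B₂ := isSelfAdjoint_conjAut A (2 * x) hB
  have e21 : ‖B₂ - B₁‖ = ‖B₁ - B‖ := norm_conjAut_two_mul_sub A x B
  -- the interpolating function and its derivative
  set G : ℝ → H →L[ℂ] H := fun σ =>
    expI B₂ σ * expI B (τ - σ) - (2 : ℂ) • (expI B₁ σ * expI B (τ - σ)) with hG
  set G' : ℝ → H →L[ℂ] H := fun σ =>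
    expI B₂ σ * (I • A.secondDifference x B) * expI B (τ - σ) +
      (2 : ℂ) • ((expI B₂ σ - expI B₁ σ) * (I • (B₁ - B)) * expI B (τ - σ)) with hG'
  have hderiv : ∀ σ : ℝ, HasDerivAt G (G' σ) σ := by
    intro σ
    have h0 : HasDerivAt (fun σ : ℝ => expI B (τ - σ)) (-((I • B) * expI B (τ - σ))) σ := by
      have := (hasDerivAt_expI B (τ - σ)).scomp σ ((hasDerivAt_id σ).const_sub τ)
      simpa [Function.comp_def] using this
    have hP2 := (hasDerivAt_expI' B₂ σ).mul h0
    have hP1 := (hasDerivAt_expI' B₁ σ).mul h0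
    have hΔ : A.secondDifference x B = B₂ - (2 : ℂ) • B₁ + B := rfl
    refine (hP2.sub (hP1.const_smul (2 : ℂ))).congr_deriv ?_
    simp only [hG', hΔ, smul_sub, smul_add, sub_mul, add_mul, mul_sub, mul_add, mul_neg,
      smul_mul_assoc, mul_smul_comm, mul_assoc, smul_neg, two_smul]
    abel
  -- the derivative bound on the interval between `0` and `τ`
  have hbound : ∀ σ ∈ Set.uIcc 0 τ,
      ‖G' σ‖ ≤ ‖A.secondDifference x B‖ + 2 * |τ| * ‖A.conjAut x B - B‖ ^ 2 := by
    intro σ hσ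
    have hστ : |σ| ≤ |τ| := abs_le_abs_of_mem_uIcc hσ
    have t1 : ‖expI B₂ σ * (I • A.secondDifference x B) * expI B (τ - σ)‖ ≤
        ‖A.secondDifference x B‖ := by
      calc ‖expI B₂ σ * (I • A.secondDifference x B) * expI B (τ - σ)‖
          ≤ ‖expI B₂ σ‖ * ‖I • A.secondDifference x B‖ * ‖expI B (τ - σ)‖ := norm_mul₃_le
        _ ≤ 1 * ‖I • A.secondDifference x B‖ * 1 := by
            gcongr
            · exact norm_expI_le_one h₂ σ
            · exact norm_expI_le_one hB _
        _ = ‖A.secondDifference x B‖ := by rw [norm_smul, Complex.norm_I]; ring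
    have t2 : ‖(expI B₂ σ - expI B₁ σ) * (I • (B₁ - B)) * expI B (τ - σ)‖ ≤
        |τ| * ‖A.conjAut x B - B‖ ^ 2 := by
      calc ‖(expI B₂ σ - expI B₁ σ) * (I • (B₁ - B)) * expI B (τ - σ)‖
          ≤ ‖expI B₂ σ - expI B₁ σ‖ * ‖I • (B₁ - B)‖ * ‖expI B (τ - σ)‖ := norm_mul₃_le
        _ ≤ (|σ| * ‖B₂ - B₁‖) * ‖I • (B₁ - B)‖ * 1 := by
            gcongr
            · exact norm_expI_sub_expI_le h₁ h₂ σ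
            · exact norm_expI_le_one hB _
        _ = |σ| * ‖A.conjAut x B - B‖ ^ 2 := by
            rw [norm_smul, Complex.norm_I, e21, hB₁]; ring
        _ ≤ |τ| * ‖A.conjAut x B - B‖ ^ 2 := by gcongr
    calc ‖G' σ‖ ≤ ‖expI B₂ σ * (I • A.secondDifference x B) * expI B (τ - σ)‖ +
          ‖(2 : ℂ) • ((expI B₂ σ - expI B₁ σ) * (I • (B₁ - B)) * expI B (τ - σ))‖ :=
          norm_add_le _ _
      _ ≤ ‖A.secondDifference x B‖ + 2 * (|τ| * ‖A.conjAut x B - B‖ ^ 2) := by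
          rw [norm_smul, RCLike.norm_ofNat]
          gcongr
      _ = ‖A.secondDifference x B‖ + 2 * |τ| * ‖A.conjAut x B - B‖ ^ 2 := by ring
  have key := (convex_uIcc 0 τ).norm_image_sub_le_of_norm_hasDerivWithin_le
    (fun σ _ => (hderiv σ).hasDerivWithinAt) hbound Set.left_mem_uIcc Set.right_mem_uIcc
  have hGτ : G τ - G 0 = A.secondDifference x (expI B τ) := by
    simp only [hG, sub_self, expI_zero, mul_one, one_mul, sub_zero, secondDifference, hB₁, hB₂,
      conjAut_expI, two_smul]
    abel
  rw [hGτ, sub_zero, Real.norm_eq_abs] at key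
  calc ‖A.secondDifference x (expI B τ)‖
      ≤ (‖A.secondDifference x B‖ + 2 * |τ| * ‖A.conjAut x B - B‖ ^ 2) * |τ| := key
    _ = |τ| * (‖A.secondDifference x B‖ + 2 * |τ| * ‖A.conjAut x B - B‖ ^ 2) := by ring

/-! ## §3. Headline (registered helper stub) -/

/-- **Second-order Duhamel bound for the unitary group of a bounded self-adjoint operator, headline
form** (all binders explicit; registered helper stub of `stub_mourreThresholdLAP`): for self-adjoint
`B ∈ B(K)` and the conjugations `𝒲(x)` of a unitary group `A`,
`‖[𝒲(x) - 1]² e^{iτB}‖ ≤ |τ| (‖[𝒲(x) - 1]² B‖ + 2|τ| ‖𝒲(x)B - B‖²)`. [folklore] -/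
theorem secondDifference_expUnitary_le :
    ∀ (K : Type) [NormedAddCommGroup K] [InnerProductSpace ℂ K] [CompleteSpace K]
      (A : Literature.Analysis.UnboundedOperators.OneParameterUnitaryGroup K) (B : K →L[ℂ] K)
      (x τ : ℝ), IsSelfAdjoint B →
        ‖A.secondDifference x
            (Summit.AtomisticToContinuum.FouriersLaw.Theorems.MourreDissolution.expI B τ)‖ ≤
          |τ| * (‖A.secondDifference x B‖ + 2 * |τ| * ‖A.conjAut x B - B‖ ^ 2) := by
  intro K _ _ _ A B x τ hB
  exact norm_secondDifference_expI_le A hB x τ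

end Summit.AtomisticToContinuum.FouriersLaw.Theorems.MourreDissolution
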